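import Summits.CriticalPhenomena.PercolationContinuityZ3.Theorems.PercAnnulusCrossingIICNotShiftInvariant
import Summits.CriticalPhenomena.PercolationContinuityZ3.Theorems.PercAnnulusCrossingIICInsertionTolerance
import Summits.CriticalPhenomena.PercolationContinuityZ3.Theorems.PercAnnulusCrossingIICPlanarKesten
import Summits.CriticalPhenomena.PercolationContinuityZ3.Theorems.PercAnnulusCrossingIICEdgeBiasAll
import HarnessLib

/-!
# Kesten's planar IIC, unconditionally: root bias, a charged pattern, and non-translation-invariance (lane RSW3, p1 gen 8)

builds on p205010 (kernel theorem, internal audit signed; external expert review pending) — used through `p_c(ℤ²) = 1/2` and the planar (A2)□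
(`exists_setToSetQuasiMultAspectAt_two_of_criticalProbI_le`, p1 gen 6: RSW ⇒ (A2)□ at aspect `(9,77)` for every `p ≥ p_c(ℤ²)`).

RSW3 lane (LANE 3 `prim-rsw3`), seat `prim-rsw3-p1` (gen 8).  Helper file (`--supports stmt-CriticalPhenomena-4575`); no definitions, no sorries.
The gen-8 structural theorems specialised to `ℤ²` at `p_c = 1/2`, where their (A2)□ hypothesis is a theorem — UNCONDITIONAL statements about
Kesten's (1986) incipient infinite cluster (every probability measure `ν` with the IIC limit property at `p_c(ℤ²)`; such `ν` exists and is unique,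
p1 gen 5):

* **`iicMeasure_real_edgeAtOrigin_gt_Z2`** — `p_c(ℤ²) < ν(s(0,y₀) open)` for each of the four edges at the origin (root bias, `…IICRootBias`);
* **`iicMeasure_real_singleEdge_pos_Z2`** — `ν(exactly the edge s(0,y₀) is open at 0) > 0` (a charged pattern; `…IICInsertionTolerance`);
* **`iicMeasure_exists_real_preimage_shift_ne_Z2`** — KESTEN'S PLANAR IIC IS NOT TRANSLATION INVARIANT (`…IICNotShiftInvariant`).
* (appended) **`iicMeasure_real_latticeEdge_gt_Z2`** — EVERY edge of `ℤ²` is open-biased under Kesten's planar IIC: `p_c(ℤ²) < ν(s(a,b) open)`,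
  unconditionally (`…IICEdgeBiasAll`).
(Contrast for the record: on `ℤ²` ONE constant `ϰ` serves (A2)□ for all `p ≥ p_c` (p1 gen 6), whereas for all large `d` no constant serves any
neighbourhood of `p_c` — `…SetToSetHighDimSupercritical`.)
References: H. Kesten, PTRF 73 (1986) Thm (3); G. Grimmett, *Percolation* (1999), §11.7; D. Basu, A. Sapozhnikov, ECP 22 (2017) no. 26.
-/

noncomputable section

namespace Summit.CriticalPhenomena.PercolationContinuityZ3.Theorems.Crossing

open MeasureTheory Filter Topology Literature.Probability.Percolation Literature.Probability.LatticeModels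
open Literature.Probability.Percolation.DCT16

/-- **The root's edges are open-biased under Kesten's planar IIC, unconditionally: `p_c(ℤ²) < ν(s(0,y₀) ∈ ω)`** for every neighbour `y₀` of
the origin and every probability measure `ν` with the IIC limit property at `p_c(ℤ²)`. [cite: Kesten1986, Thm. (3)] -/
theorem iicMeasure_real_edgeAtOrigin_gt_Z2 {ν : Measure (BondConfig (Site 2))} [IsProbabilityMeasure ν]
    (hν : ∀ (F : Finset (Sym2 (Site 2))) (E : Set (BondConfig (Site 2))), MeasurableSet E → DeterminedBy E ↑F →
      Tendsto (fun n : ℕ => (bondPercolation (zdGraph 2) (criticalProbI 2)).real (E ∩ siteToBoundary 2 n) /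
        oneArmProb 2 (criticalProbI 2) n) atTop (𝓝 (ν.real E)))
    {y₀ : Site 2} (hy₀ : (zdGraph 2).Adj 0 y₀) :
    ((criticalProbI 2 : unitInterval) : ℝ) < ν.real {ω : BondConfig (Site 2) | s((0 : Site 2), y₀) ∈ ω} := by
  obtain ⟨ϰ, hϰ, hA2⟩ := exists_setToSetQuasiMultAspectAt_two_of_criticalProbI_le
  have hpc0 : 0 < ((criticalProbI 2 : unitInterval) : ℝ) := by rw [coe_criticalProbI]; exact criticalProb_zd_pos 2 (by omega)
  have hpc1 : ((criticalProbI 2 : unitInterval) : ℝ) < 1 := by rw [coe_criticalProbI]; exact criticalProb_zd_lt_one le_rfl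
  exact iicMeasure_real_edgeAtOrigin_gt (d := 2) (by omega) (criticalProbI 2) hpc0 hpc1 (by norm_num) hϰ (hA2 _ le_rfl) hν hy₀

/-- **A charged pattern, unconditionally**: under Kesten's planar IIC the pattern 'exactly the edge `s(0,y₀)` is open at the origin' has positive
probability, for every neighbour `y₀` of `0`. [cite: Kesten1986, Thm. (3)] -/
theorem iicMeasure_real_singleEdge_pos_Z2 {ν : Measure (BondConfig (Site 2))}
    (hν : ∀ (F : Finset (Sym2 (Site 2))) (E : Set (BondConfig (Site 2))), MeasurableSet E → DeterminedBy E ↑F →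
      Tendsto (fun n : ℕ => (bondPercolation (zdGraph 2) (criticalProbI 2)).real (E ∩ siteToBoundary 2 n) /
        oneArmProb 2 (criticalProbI 2) n) atTop (𝓝 (ν.real E)))
    {y₀ : Site 2} (hy₀ : (zdGraph 2).Adj 0 y₀) :
    0 < ν.real ({ω : BondConfig (Site 2) | s((0 : Site 2), y₀) ∈ ω} ∩
      {ω | ∀ y : Site 2, (zdGraph 2).Adj 0 y → y ≠ y₀ → s((0 : Site 2), y) ∉ ω}) := by
  obtain ⟨ϰ, hϰ, hA2⟩ := exists_setToSetQuasiMultAspectAt_two_of_criticalProbI_le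
  have hpc0 : 0 < ((criticalProbI 2 : unitInterval) : ℝ) := by rw [coe_criticalProbI]; exact criticalProb_zd_pos 2 (by omega)
  have hpc1 : ((criticalProbI 2 : unitInterval) : ℝ) < 1 := by rw [coe_criticalProbI]; exact criticalProb_zd_lt_one le_rfl
  exact iicMeasure_real_singleEdge_pos (d := 2) (by omega) (criticalProbI 2) hpc0 hpc1 (by norm_num) hϰ (hA2 _ le_rfl) hν hy₀

/-- **KESTEN'S PLANAR IIC IS NOT TRANSLATION INVARIANT, unconditionally**: for every probability measure `ν` with the IIC limit property at
`p_c(ℤ²)` and every neighbour `y₀` of `0` there is `v ∈ ℤ²` with `ν({ω | ω + v ∈ {s(0,y₀) open}}) ≠ ν(s(0,y₀) open)` (indeed for all but finitely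
many `v` the left side is smaller: `iicMeasure_eventually_real_preimage_shift_lt` with the planar (A2)□). [cite: Kesten1986, Thm. (3), (1.12)–(1.13)] -/
theorem iicMeasure_exists_real_preimage_shift_ne_Z2 {ν : Measure (BondConfig (Site 2))} [IsProbabilityMeasure ν]
    (hν : ∀ (F : Finset (Sym2 (Site 2))) (E : Set (BondConfig (Site 2))), MeasurableSet E → DeterminedBy E ↑F →
      Tendsto (fun n : ℕ => (bondPercolation (zdGraph 2) (criticalProbI 2)).real (E ∩ siteToBoundary 2 n) /
        oneArmProb 2 (criticalProbI 2) n) atTop (𝓝 (ν.real E)))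
    {y₀ : Site 2} (hy₀ : (zdGraph 2).Adj 0 y₀) :
    ∃ v : Site 2, ν.real (BondConfig.relabel (sym2Equiv (Site.shift v)) ⁻¹' {ω : BondConfig (Site 2) | s((0 : Site 2), y₀) ∈ ω}) ≠
      ν.real {ω : BondConfig (Site 2) | s((0 : Site 2), y₀) ∈ ω} := by
  obtain ⟨ϰ, hϰ, hA2⟩ := exists_setToSetQuasiMultAspectAt_two_of_criticalProbI_le
  exact iicMeasure_exists_real_preimage_shift_ne (d := 2) le_rfl (by norm_num) (by norm_num) hϰ (hA2 _ le_rfl) hν hy₀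

/-- The eventual strict inequality on `ℤ²`, unconditionally: for all but finitely many `v`, `ν({ω | ω + v ∈ {s(0,y₀) open}}) < ν(s(0,y₀) open)`.
[cite: Kesten1986, Thm. (3), (1.12)–(1.13)] -/
theorem iicMeasure_eventually_real_preimage_shift_lt_Z2 {ν : Measure (BondConfig (Site 2))} [IsProbabilityMeasure ν]
    (hν : ∀ (F : Finset (Sym2 (Site 2))) (E : Set (BondConfig (Site 2))), MeasurableSet E → DeterminedBy E ↑F →
      Tendsto (fun n : ℕ => (bondPercolation (zdGraph 2) (criticalProbI 2)).real (E ∩ siteToBoundary 2 n) /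
        oneArmProb 2 (criticalProbI 2) n) atTop (𝓝 (ν.real E)))
    {y₀ : Site 2} (hy₀ : (zdGraph 2).Adj 0 y₀) :
    ∀ᶠ v : Site 2 in cofinite, ν.real (BondConfig.relabel (sym2Equiv (Site.shift v)) ⁻¹' {ω : BondConfig (Site 2) | s((0 : Site 2), y₀) ∈ ω}) <
      ν.real {ω : BondConfig (Site 2) | s((0 : Site 2), y₀) ∈ ω} := by
  obtain ⟨ϰ, hϰ, hA2⟩ := exists_setToSetQuasiMultAspectAt_two_of_criticalProbI_le
  exact iicMeasure_eventually_real_preimage_shift_lt (d := 2) le_rfl (by norm_num) (by norm_num) hϰ (hA2 _ le_rfl) hν hy₀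

/-- **Every edge of `ℤ²` is open-biased under Kesten's planar IIC, unconditionally: `p_c(ℤ²) < ν(s(a,b) ∈ ω)`** for every lattice edge `a ∼ b`
and every probability measure `ν` with the IIC limit property at `p_c(ℤ²)` (two-staircase lemma + planar (A2)□). [cite: Kesten1986, Thm. (3)] -/
theorem iicMeasure_real_latticeEdge_gt_Z2 {ν : Measure (BondConfig (Site 2))} [IsProbabilityMeasure ν]
    (hν : ∀ (F : Finset (Sym2 (Site 2))) (E : Set (BondConfig (Site 2))), MeasurableSet E → DeterminedBy E ↑F →
      Tendsto (fun n : ℕ => (bondPercolation (zdGraph 2) (criticalProbI 2)).real (E ∩ siteToBoundary 2 n) /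
        oneArmProb 2 (criticalProbI 2) n) atTop (𝓝 (ν.real E)))
    {a b : Site 2} (hab : (zdGraph 2).Adj a b) :
    ((criticalProbI 2 : unitInterval) : ℝ) < ν.real {ω : BondConfig (Site 2) | s(a, b) ∈ ω} := by
  obtain ⟨ϰ, hϰ, hA2⟩ := exists_setToSetQuasiMultAspectAt_two_of_criticalProbI_le
  have hpc0 : 0 < ((criticalProbI 2 : unitInterval) : ℝ) := by rw [coe_criticalProbI]; exact criticalProb_zd_pos 2 (by omega)
  have hpc1 : ((criticalProbI 2 : unitInterval) : ℝ) < 1 := by rw [coe_criticalProbI]; exact criticalProb_zd_lt_one le_rfl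
  exact iicMeasure_real_latticeEdge_gt (d := 2) le_rfl (criticalProbI 2) hpc0 hpc1 (by norm_num) hϰ (hA2 _ le_rfl) hν hab

end Summit.CriticalPhenomena.PercolationContinuityZ3.Theorems.Crossing
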